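import Summits.QuantumAdvantage.AdviceFreeQNC0.BlockRigidity
import HarnessLib

/-!
# Cell qa-qnc0, `p = 3` — PATH EXPANSION of a chain of site operators on the register chain, and the word ↦ end-state bijection

Tools for the uniform block-norm theorem `BlockNormUniformProof.blockNormUniform3` (planner qa-qnc0-p1 g20's CONJECTURE `BlockNormUniform3`,
`BondTwistLocal.lean` §8):

* `pathSgn` (the product of the signs read along a word; `±1`) and **`chainOp_eq_sum`**:
  `(T_0 ⋯ T_{m−1} f)(σ) = 2^{−m} Σ_{w ∈ {0,1}^m} Φ_w · sgn(σ,w) · f(σ·w)` (`Φ_w = phaseProd`, `σ·w = run σ w`);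
* reading a word of length `2r` from `(Q, s, reg)`: the end position is translation-covariant in `Q` (`run_pos_add`), the end
  register is the word (`run_reg_ofFn`) and the end spin determines the start spin (`run_spin`, `spinAfter_not`), so
  **`(Q, s, w) ↦ run (Q, s, reg₀) w` is a bijection onto `RegState r`** (`run_bijective`) — whence the re-indexing identity
  `Σ_{Q,s,w} F(run (Q,s,reg₀) w) = Σ_τ F τ` (`sum_run_eq`).

WHAT THIS IS NOT: no norm bound here; crux 22907 untouched; no separation.
-/

noncomputable section

namespace Summit.QuantumAdvantage.AdviceFreeQNC0

open Finset Literature.Computability.QuantumComplexity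

namespace BondTwist3

variable {r : ℕ}

/-! ## Path signs and the path expansion -/

/-- The product of the signs read along the word `bs` from `σ` through the chain `l` (`±1`). -/
def pathSgn : List (ℂ × (RegState r → Bool → Bool)) → RegState r → List Bool → ℂ
  | p :: l, σ, b :: bs => (if p.2 σ b then -1 else 1) * pathSgn l (nextState σ b) bs
  | _, _, _ => 1

/-- Path signs are `±1`. -/
theorem pathSgn_pm (l : List (ℂ × (RegState r → Bool → Bool))) (σ : RegState r) (bs : List Bool) :
    pathSgn l σ bs = 1 ∨ pathSgn l σ bs = -1 := by
  induction l generalizing σ bs with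
  | nil => left; cases bs <;> rfl
  | cons p l ih =>
    cases bs with
    | nil => left; rfl
    | cons b bs =>
      show (if p.2 σ b then -1 else 1) * pathSgn l (nextState σ b) bs = 1 ∨
        (if p.2 σ b then -1 else 1) * pathSgn l (nextState σ b) bs = -1
      rcases ih (nextState σ b) bs with h | h <;> rw [h] <;> cases p.2 σ b <;> simp

/-- Path signs have norm `1`. -/
theorem norm_pathSgn (l : List (ℂ × (RegState r → Bool → Bool))) (σ : RegState r) (bs : List Bool) :
    ‖pathSgn l σ bs‖ = 1 := by
  rcases pathSgn_pm l σ bs with h | h <;> rw [h] <;> simp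

/-- Splitting a sum over words of length `k + 1` by the first letter. -/
theorem sum_words_succ {k : ℕ} (F : (Fin (k + 1) → Bool) → ℂ) :
    ∑ w : Fin (k + 1) → Bool, F w = ∑ b : Bool, ∑ w' : Fin k → Bool, F (Fin.cons b w') := by
  rw [← Fintype.sum_prod_type']
  exact (Fintype.sum_equiv (Fin.consEquiv fun _ => Bool) (fun p => F (Fin.cons p.1 p.2)) F fun p => rfl).symm

/-- `ofFn (cons b w') = b :: ofFn w'`. -/
theorem ofFn_cons' {k : ℕ} (b : Bool) (w' : Fin k → Bool) : List.ofFn (Fin.cons b w' : Fin (k + 1) → Bool) = b :: List.ofFn w' := by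
  rw [List.ofFn_succ]
  simp only [Fin.cons_zero, Fin.cons_succ]

/-- **PATH EXPANSION**: `(T_0 ⋯ T_{m−1} f)(σ) = 2^{−m} Σ_w Φ_w · sgn(σ,w) · f(σ·w)`. -/
theorem chainOp_eq_sum (l : List (ℂ × (RegState r → Bool → Bool))) (f : RegState r → ℂ) (σ : RegState r) :
    chainOp l f σ = (1 / 2 : ℂ) ^ l.length *
      ∑ w : Fin l.length → Bool, phaseProd l (List.ofFn w) * pathSgn l σ (List.ofFn w) * f (run σ (List.ofFn w)) := by
  induction l generalizing σ with
  | nil =>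
    simp only [chainOp_nil, List.length_nil, pow_zero, one_mul]
    rw [Fintype.sum_unique]
    simp [phaseProd, pathSgn, run_nil]
  | cons p l ih =>
    have hL : chainOp (p :: l) f σ = ((if p.2 σ false then (-1 : ℂ) else 1) * chainOp l f (nextState σ false) +
        p.1 * (if p.2 σ true then (-1 : ℂ) else 1) * chainOp l f (nextState σ true)) / 2 := rfl
    have hP : ∀ (b : Bool) (bs : List Bool), phaseProd (p :: l) (b :: bs) = (if b then p.1 else 1) * phaseProd l bs :=
      fun _ _ => rfl
    have hS : ∀ (b : Bool) (bs : List Bool),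
        pathSgn (p :: l) σ (b :: bs) = (if p.2 σ b then -1 else 1) * pathSgn l (nextState σ b) bs := fun _ _ => rfl
    rw [hL, ih (nextState σ false), ih (nextState σ true), List.length_cons, sum_words_succ, Fintype.sum_bool]
    simp only [ofFn_cons', run_cons, hP, hS, if_true, Bool.false_eq_true, if_false, one_mul]
    simp only [Finset.mul_sum, ← Finset.sum_add_distrib, Finset.sum_div]
    refine Finset.sum_congr rfl fun w _ => ?_
    rw [pow_succ]
    ring

/-- The path expansion with a prescribed length. -/
theorem chainOp_eq_sum' {m : ℕ} (l : List (ℂ × (RegState r → Bool → Bool))) (hm : l.length = m) (f : RegState r → ℂ)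
    (σ : RegState r) :
    chainOp l f σ = (1 / 2 : ℂ) ^ m *
      ∑ w : Fin m → Bool, phaseProd l (List.ofFn w) * pathSgn l σ (List.ofFn w) * f (run σ (List.ofFn w)) := by
  subst hm
  exact chainOp_eq_sum l f σ

/-! ## Runs of length `2r`: translation covariance and the end-state bijection -/

/-- One step is translation-covariant in the position. -/
theorem nextState_pos_add (P d : ZMod 3) (s : Bool) (reg : Fin (2 * r) → Bool) (b : Bool) :
    nextState ((P + d, s, reg) : RegState r) b = ((nextState ((P, s, reg) : RegState r) b).1 + d,
      (nextState ((P, s, reg) : RegState r) b).2.1, (nextState ((P, s, reg) : RegState r) b).2.2) := by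
  simp only [nextState]
  refine Prod.ext ?_ rfl
  simp only
  ring

/-- Runs are translation-covariant in the position; spin and register do not see the position. -/
theorem run_pos_add (W : List Bool) : ∀ (P d : ZMod 3) (s : Bool) (reg : Fin (2 * r) → Bool),
    run ((P + d, s, reg) : RegState r) W = ((run ((P, s, reg) : RegState r) W).1 + d,
      (run ((P, s, reg) : RegState r) W).2.1, (run ((P, s, reg) : RegState r) W).2.2) := by
  induction W with
  | nil => intro P d s reg; rfl
  | cons b W ih =>
    intro P d s reg
    rw [run_cons, run_cons, nextState_pos_add]
    set τ := nextState ((P, s, reg) : RegState r) b with hτ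
    have e : τ = (τ.1, τ.2.1, τ.2.2) := by simp
    rw [ih τ.1 d τ.2.1 τ.2.2, ← e]

/-- The spin after one step determines the spin before (for a known letter). -/
theorem nextState_spin (σ : RegState r) (b : Bool) : (nextState σ b).2.1 = (if b then σ.2.1 else !σ.2.1) := rfl

/-- The register after one step. -/
theorem nextState_reg (σ : RegState r) (b : Bool) : (nextState σ b).2.2 = shiftIn σ.2.2 b := rfl

/-- After reading a word `W` of length `k`, register position `j` holds the old bit `j + k` if that is `< 2r`, else the letter
`j + k − 2r` of `W`. -/
theorem run_reg_eq (W : List Bool) : ∀ (k : ℕ), W.length = k → ∀ (σ : RegState r) (j : Fin (2 * r)),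
    (run σ W).2.2 j = if h : j.val + k < 2 * r then σ.2.2 ⟨j.val + k, h⟩ else W.getD (j.val + k - 2 * r) false := by
  induction W with
  | nil => intro k hk σ j; subst hk; simp [run_nil]
  | cons b W ih =>
    intro k hk σ j
    obtain ⟨k', rfl⟩ : ∃ k', k = k' + 1 := ⟨W.length, by simpa using hk.symm⟩
    have hk' : W.length = k' := by simpa using hk
    rw [run_cons, ih k' hk' (nextState σ b) j, nextState_reg]
    simp only [shiftIn]
    by_cases h1 : j.val + k' + 1 < 2 * r
    · rw [dif_pos (show j.val + k' < 2 * r by omega), dif_pos h1, dif_pos (show j.val + (k' + 1) < 2 * r by omega)]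
      congr 1
    · rw [dif_neg (show ¬ (j.val + (k' + 1) < 2 * r) by omega)]
      by_cases h2 : j.val + k' < 2 * r
      · rw [dif_pos h2, dif_neg h1, show j.val + (k' + 1) - 2 * r = 0 by omega, List.getD_cons_zero]
      · rw [dif_neg h2, show j.val + (k' + 1) - 2 * r = (j.val + k' - 2 * r) + 1 by omega, List.getD_cons_succ]

/-- After reading a word of length exactly `2r`, the register IS the word. -/
theorem run_reg_ofFn (σ : RegState r) (w : Fin (2 * r) → Bool) : (run σ (List.ofFn w)).2.2 = w := by
  funext j
  rw [run_reg_eq (List.ofFn w) (2 * r) (List.length_ofFn) σ j, dif_neg (by omega), Nat.add_sub_cancel,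
    List.getD_eq_getElem _ _ (by simp), List.getElem_ofFn]

/-- The spin after reading `W` from spin `s`: every `false` letter flips it. -/
def spinAfter : Bool → List Bool → Bool
  | s, [] => s
  | s, b :: W => spinAfter (if b then s else !s) W

/-- The end spin of a run. -/
theorem run_spin (W : List Bool) : ∀ (P : ZMod 3) (s : Bool) (reg : Fin (2 * r) → Bool),
    (run ((P, s, reg) : RegState r) W).2.1 = spinAfter s W := by
  induction W with
  | nil => intro P s reg; rfl
  | cons b W ih =>
    intro P s reg
    rw [run_cons]
    exact ih _ _ _

/-- Flipping the start spin flips the end spin. -/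
theorem spinAfter_not (W : List Bool) : ∀ s : Bool, spinAfter (!s) W = !spinAfter s W := by
  induction W with
  | nil => intro s; rfl
  | cons b W ih =>
    intro s
    cases b
    · show spinAfter (!!s) W = !spinAfter (!s) W
      exact ih (!s)
    · exact ih s

/-- **Injectivity of the start data**: the end state of a word of length `2r` read from `(Q, s, reg₀)` determines `(Q, s, w)`. -/
theorem run_injective_start (reg₀ : Fin (2 * r) → Bool) :
    Function.Injective fun x : ZMod 3 × Bool × (Fin (2 * r) → Bool) => run ((x.1, x.2.1, reg₀) : RegState r) (List.ofFn x.2.2) := by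
  rintro ⟨Q, s, w⟩ ⟨Q', s', w'⟩ h
  simp only at h
  have hw : w = w' := by
    have := congrArg (fun τ : RegState r => τ.2.2) h
    simp only [run_reg_ofFn] at this
    exact this
  subst hw
  have hs : s = s' := by
    have e : (run ((Q, s, reg₀) : RegState r) (List.ofFn w)).2.1 = (run ((Q', s', reg₀) : RegState r) (List.ofFn w)).2.1 := by
      rw [h]
    rw [run_spin, run_spin] at e
    by_contra hne
    have hs' : s' = !s := by cases s <;> cases s' <;> simp_all
    rw [hs', spinAfter_not] at e
    cases spinAfter s (List.ofFn w) <;> simp at e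
  subst hs
  have hQ : Q = Q' := by
    have e : (run ((Q, s, reg₀) : RegState r) (List.ofFn w)).1 = (run ((Q', s, reg₀) : RegState r) (List.ofFn w)).1 := by
      rw [h]
    have e2 := run_pos_add (List.ofFn w) Q (Q' - Q) s reg₀
    rw [show Q + (Q' - Q) = Q' by ring] at e2
    have e3 : (run ((Q', s, reg₀) : RegState r) (List.ofFn w)).1 =
        (run ((Q, s, reg₀) : RegState r) (List.ofFn w)).1 + (Q' - Q) := by rw [e2]
    have h0 : Q' - Q = 0 := by linear_combination -(e.trans e3)
    linear_combination -h0
  subst hQ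
  rfl

/-- **The end-state bijection**: `(Q, s, w) ↦ run (Q, s, reg₀) w` is a bijection of `ℤ/3 × Bool × {0,1}^{2r}` onto `RegState r`. -/
theorem run_bijective (reg₀ : Fin (2 * r) → Bool) :
    Function.Bijective fun x : ZMod 3 × Bool × (Fin (2 * r) → Bool) => run ((x.1, x.2.1, reg₀) : RegState r) (List.ofFn x.2.2) :=
  (Fintype.bijective_iff_injective_and_card _).2 ⟨run_injective_start reg₀, rfl⟩

/-- **Re-indexing by end states**: `Σ_{Q,s,w} F(run (Q,s,reg₀) w) = Σ_τ F τ`. -/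
theorem sum_run_eq (reg₀ : Fin (2 * r) → Bool) (F : RegState r → ℝ) :
    ∑ x : ZMod 3 × Bool × (Fin (2 * r) → Bool), F (run ((x.1, x.2.1, reg₀) : RegState r) (List.ofFn x.2.2)) = ∑ τ : RegState r, F τ :=
  Equiv.sum_comp (Equiv.ofBijective _ (run_bijective reg₀)) F

end BondTwist3

end Summit.QuantumAdvantage.AdviceFreeQNC0

end
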